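import Mathlib
import Summits.KontsevichZagierPeriods.Zeta5Search.Certificates.RayC1Window
import Summits.KontsevichZagierPeriods.Zeta5Search.Certificates.RayC1KernelClassR8
import HarnessLib

/-!
# (N∃ᶠ) ⊕ (M) on the calibration ray C1: infinitely many C1 approximants satisfy `0 < |ζ(5) − p/q| < q^{−γ}`, `γ ≤ 0.8673`
(fam-tele g17, S4-C1 LITE file L6 — the C1 copy of `RecordRayThm1Frequently`)

HONEST FRAMING: systematic search; no irrationality claim unless certified.  ONE by-name theorem combining the
hypothesis-free exponent clause (M) of the C1 ray (`RayC1.c1_exponent_classR8`: for `0 ≤ γ ≤ 0.8673`, eventually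
`|ζ(5) − P_n/Q_n| < 1/q_n^γ` with the integers `p_n = kMPR8 n · P_n`, `q_n = kMPR8 n · |Q_n| ≥ 1`) with the non-vanishing
clause (N∃ᶠ) (`RayC1Window.c1Pair_frequently_ne_zero`: `Q_n ζ(5) − P_n ≠ 0` for infinitely many `n`) by
`Filter.Frequently.and_eventually`.  C1 is the CALIBRATION ray `a = (18,32,23,30,28,38,43,30)`; `γ < 1`: no irrationality
content, no record moves; how this may be worded is the referees' call, not this file's.
-/

namespace Summit.KontsevichZagierPeriods.Zeta5Search.RayC1.Generic

open Filter
open Literature.NumberTheory.Transcendental (zetaValue)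

/-- **(N∃ᶠ) ⊕ (M) for the C1 ray.**  For every `0 ≤ γ ≤ 0.8673` and infinitely many `n`, the integers
`p = kMPR8 n · P_n`, `q = kMPR8 n · |Q_n| ≥ 1` satisfy `0 < |ζ(5) − P_n/Q_n| < 1/q^γ` (and `P_n/Q_n = p/(±q)`).
HONEST FRAMING: `γ < 1`; NOT an irrationality statement; C1 is the calibration ray. -/
theorem c1_thm1_frequently {γ : ℝ} (h0 : 0 ≤ γ) (hγ : γ ≤ 8673 / 10000) :
    ∃ᶠ n : ℕ in atTop, ∃ p : ℤ, ∃ q : ℕ, 1 ≤ q ∧ (q : ℚ) = kMPR8 n * |(c1Q n : ℚ)| ∧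
      (p : ℚ) = kMPR8 n * c1P n ∧ 0 < |zetaValue 5 - (c1P n : ℝ) / (c1Q n : ℝ)| ∧
        |zetaValue 5 - (c1P n : ℝ) / (c1Q n : ℝ)| < 1 / (q : ℝ) ^ γ := by
  refine (c1Pair_frequently_ne_zero.and_eventually (c1_exponent_classR8 h0 hγ)).mono fun n hn => ?_
  obtain ⟨hL, p, q, hq, hqQ, hpP, hlt⟩ := hn
  have hQ : (c1Q n : ℝ) ≠ 0 := by
    intro hQ0
    have hz : c1Q n = 0 := by exact_mod_cast hQ0
    simp [hz] at hqQ
    omega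
  refine ⟨p, q, hq, hqQ, hpP, ?_, hlt⟩
  rw [abs_pos, sub_ne_zero]
  intro h
  apply hL
  rw [h]
  field_simp
  ring

end Summit.KontsevichZagierPeriods.Zeta5Search.RayC1.Generic
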